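import Summits.AnomalousDissipation.AnomalousDissipation.Theorems.SawtoothPulseCascadeK1LocalisedCascadeStripBlockVLog2
import Summits.AnomalousDissipation.AnomalousDissipation.Theorems.SawtoothPulseCascadeK1LocalisedCascadeStripStepVLog

/-!
# K1loc, line `Spectral` / thin start — helper: LEDGER STEP (S-V) WITH THE SHARP KERNEL CONSTANTS — ALL KERNEL CONSTANTS SHARP (Log2)

Helper file of the prover lane on the crux `K1LocalisedCascade` (stmt-AnomalousDissipation-19491), route
`SawtoothPulseCascade` (S-D fibre ledger; memo v12 §14 lever (1)).  `…StripStepV.tsum_strip_vstep_le` with `…StripBlockVLog` in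
place of `…StripBlockV`: `A = 4/π + (2/π)·log((K+Q₂+ΛG)/D) + 1/D + 1/(πD²)`, `τ = 1/(2D)`, `D = ΛG − K − Q₂`:
**`tsum_strip_vstep_le_log`**.  No definitions; no statement about the crux.
[cite: Grafakos2014, Prop. 3.1.2 (5), Prop. 3.2.7 (3), §3.1.3] [cite: ElgindiLissMattingly2025, §1 (slope ±1 branches)] [problem: turb]

(Log2 variant: the input trapezoid `χ` is also paid by the log bound of `…TrapezoidLog`, i.e. `(Q₁+Q₂)/(Q₂−Q₁)` is replaced by
`4/π + (2/π)·log((Q₁+Q₂)/(Q₂−Q₁)) + 1/(Q₂−Q₁) + 1/(π(Q₂−Q₁)²)` throughout; built on `…WindowBlockVLog2/HLog2`.)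
-/

-- `Summit.<Summit>.<Problem>`: single-conjunct summit, the duplicate namespace segment is deliberate.
set_option linter.dupNamespace false

noncomputable section

namespace Summit.AnomalousDissipation.AnomalousDissipation.Theorems.SawtoothPulseCascade.K1Window

open MeasureTheory Set Filter Topology UnitAddTorus Function Complex Metric
open scoped Real ENNReal
open Literature.Analysis Literature.Analysis.FunctionSpaces Literature.Analysis.FunctionSpaces.Torus Literature.Analysis.FluidPDE
open Literature.Analysis.FluidPDE.ShearStage
open Literature.Analysis.FluidPDE.SawtoothCascade Literature.Analysis.FluidPDE.SawtoothCascade.CascadeParams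
open Summit.AnomalousDissipation.AnomalousDissipation.Theorems.SawtoothPulseCascade.K1Start
open Summit.AnomalousDissipation.AnomalousDissipation.Theorems.SawtoothPulseCascade.K1Flat
open Summit.AnomalousDissipation.AnomalousDissipation.Theorems.SawtoothPulseCascade.K1Ledger.From

/-! ## The strip class through the V half-step, sharp kernel constants -/

section Cascade

variable (P : CascadeParams)

/-- **LEDGER STEP (S-V), sharp kernel constants**: the strip energy of `a_{j+1}` below `K` is at most the low-fibre energy of `b_j` below `Λ`, plus the
junk-plus-shallow-class square of the choppable block `Λ ≤ |k₁| ≤ R`, plus the far tail beyond `R` (see the file header).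
[cite: Grafakos2014, Prop. 3.1.2 (5), Prop. 3.2.7 (3), §3.1.3] -/
theorem tsum_strip_vstep_le_log2 {G : ℕ} (hγ : P.γ = G) (hδ₀ : 0 < P.δ₀) (hd : 0 < P.d) (hN₀ : 1 ≤ P.N₀) (hρN : 1 ≤ P.ρN)
    (a b : ℕ → UnitAddTorus (Fin 2) → ℝ) (has : ∀ j, IsSmooth (a j)) (h0 : a 0 = datum)
    (hb : ∀ j, b j = a j ∘ shearMap 0 1 (amp ⟨P.U j, P.U_periodic j, P.contDiff_U (P.δ_pos hδ₀ hd j)⟩ P.γ))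
    (hab : ∀ j, a (j + 1) = b j ∘ shearMap 1 0 (amp ⟨P.U j, P.U_periodic j, P.contDiff_U (P.δ_pos hδ₀ hd j)⟩ P.γ))
    (j : ℕ) {K Q₁ Q₂ Λ R : ℕ} (hQ : Q₁ < Q₂) (hΛ : K + Q₂ < Λ * G) (hR : 0 < R)
    {d₀ M ε₀ : ℝ} (hd₀ : 0 < d₀) (hM : 1 ≤ M) (hMδ : M * P.δ j < π / 2) (hMd : M * P.δ j < π * P.N j * d₀)
    (hAd : 8 * (1 / (2 * (((Λ * G : ℕ) : ℝ) - (K + Q₂ : ℕ)))) ≤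
      (4 / π + 2 / π * Real.log ((((K + Q₂ : ℕ) : ℝ) + (Λ * G : ℕ)) / (((Λ * G : ℕ) : ℝ) - (K + Q₂ : ℕ))) +
        1 / (((Λ * G : ℕ) : ℝ) - (K + Q₂ : ℕ)) + 1 / (π * ((((Λ * G : ℕ) : ℝ) - (K + Q₂ : ℕ))) ^ 2)) * d₀)
    (hε0 : 0 ≤ ε₀)
    (hε : (4 / π + 2 / π * Real.log ((((K + Q₂ : ℕ) : ℝ) + (Λ * G : ℕ)) / (((Λ * G : ℕ) : ℝ) - (K + Q₂ : ℕ))) +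
        1 / (((Λ * G : ℕ) : ℝ) - (K + Q₂ : ℕ)) + 1 / (π * ((((Λ * G : ℕ) : ℝ) - (K + Q₂ : ℕ))) ^ 2)) *
      (2 * π * ((R * G : ℕ) : ℝ) * (Real.exp (-(M ^ 2 / 2)) / (2 * P.N j))) ≤ ε₀) :
    ∑' k : Fin 2 → ℤ, (if |k 0| < (K : ℤ) then (1 : ℝ) else 0) * ‖mFourierCoeff (fun x => (a (j + 1) x : ℂ)) k‖ ^ 2 ≤
      ∑' k : Fin 2 → ℤ, (if |k 1| < (Λ : ℤ) then (1 : ℝ) else 0) * ‖mFourierCoeff (fun x => (b j x : ℂ)) k‖ ^ 2 +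
        ((4 / π + 2 / π * Real.log (((Q₁ : ℝ) + Q₂) / ((Q₂ : ℝ) - Q₁)) + 1 / ((Q₂ : ℝ) - Q₁) +
        1 / (π * ((Q₂ : ℝ) - Q₁) ^ 2)) *
            (ε₀ + (4 / π + 2 / π * Real.log ((((K + Q₂ : ℕ) : ℝ) + (Λ * G : ℕ)) / (((Λ * G : ℕ) : ℝ) - (K + Q₂ : ℕ))) +
        1 / (((Λ * G : ℕ) : ℝ) - (K + Q₂ : ℕ)) + 1 / (π * ((((Λ * G : ℕ) : ℝ) - (K + Q₂ : ℕ))) ^ 2)) *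
              Real.sqrt ((2 * P.N j : ℕ) * (4 * d₀))) +
          Real.sqrt (∑' k : Fin 2 → ℤ, (if (Λ : ℤ) ≤ |k 1| ∧ |k 1| ≤ R ∧ (Q₁ : ℤ) < |k 0| then (1 : ℝ) else 0) *
            ‖mFourierCoeff (fun x => (b j x : ℂ)) k‖ ^ 2)) ^ 2 +
        ((1 + P.γ) ^ (2 * (j + 1)) / R) ^ 2 := by
  classical
  have hγ0 : 0 ≤ P.γ := by rw [hγ]; exact Nat.cast_nonneg G
  set Ψ : ShearProfile := amp ⟨P.U j, P.U_periodic j, P.contDiff_U (P.δ_pos hδ₀ hd j)⟩ P.γ with hΨ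
  set bC : UnitAddTorus (Fin 2) → ℂ := fun x => (b j x : ℂ) with hbC
  set aC : UnitAddTorus (Fin 2) → ℂ := fun x => (a (j + 1) x : ℂ) with haC
  have hbs : IsSmooth (b j) := isSmooth_b P hδ₀ hd a b has hb j
  have hbc : Continuous bC := Complex.continuous_ofReal.comp hbs.continuous
  have hbsum : Summable fun k => ‖mFourierCoeff bC k‖ := summable_norm_mFourierCoeff_ofReal_of_isSmooth hbs
  have hb1 : ∀ x, ‖bC x‖ ≤ 1 := fun x => by
    simp only [hbC, Complex.norm_real, Real.norm_eq_abs]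
    exact (abs_iterate_le_one P hδ₀ hd a b h0 hb hab j).2 x
  have haC' : aC = bC ∘ shearMap 1 0 Ψ := by
    show (fun x => (a (j + 1) x : ℂ)) = (fun x => (b j x : ℂ)) ∘ shearMap 1 0 Ψ
    rw [hab j]; rfl
  have hac : Continuous aC := by rw [haC']; exact hbc.comp (continuous_shearMap 1 0 Ψ)
  -- the window as a finite set
  set W : Finset (Fin 2 → ℤ) := ((Finset.Icc (-(K : ℤ)) K ×ˢ Finset.Icc (-(R : ℤ)) R).filter
      (fun q : ℤ × ℤ => |q.1| < (K : ℤ) ∧ (Λ : ℤ) ≤ |q.2| ∧ |q.2| ≤ R)).image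
      (fun q : ℤ × ℤ => (fun i : Fin 2 => if i = 0 then q.1 else q.2)) with hWdef
  have hW : ∀ k ∈ W, |k 0| < (K : ℤ) ∧ (Λ : ℤ) ≤ |k 1| ∧ |k 1| ≤ R := by
    intro k hk
    obtain ⟨q, hq, rfl⟩ := Finset.mem_image.mp hk
    have h := (Finset.mem_filter.mp hq).2
    simpa using h
  have hWmem : ∀ k : Fin 2 → ℤ, |k 0| < (K : ℤ) → (Λ : ℤ) ≤ |k 1| → |k 1| ≤ (R : ℤ) → k ∈ W := by
    intro k h0 h1 h2
    refine Finset.mem_image.mpr ⟨(k 0, k 1), ?_, ?_⟩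
    · refine Finset.mem_filter.mpr ⟨Finset.mem_product.mpr ⟨Finset.mem_Icc.mpr ?_, Finset.mem_Icc.mpr ?_⟩, h0, h1, h2⟩
      · exact ⟨by linarith [neg_abs_le (k 0)], by linarith [le_abs_self (k 0)]⟩
      · exact ⟨by linarith [neg_abs_le (k 1)], by linarith [le_abs_self (k 1)]⟩
    · funext i; fin_cases i <;> simp
  -- summability of the three pieces
  set c : (Fin 2 → ℤ) → ℝ := fun k => ‖mFourierCoeff aC k‖ ^ 2 with hc
  have hcs : Summable c := (hasSum_sq_mFourierCoeff_of_continuous hac).summable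
  have hc0 : ∀ k, 0 ≤ c k := fun k => sq_nonneg _
  have hI : ∀ (p : (Fin 2 → ℤ) → Prop) [DecidablePred p], Summable fun k => (if p k then (1 : ℝ) else 0) * c k := by
    intro p _
    refine Summable.of_nonneg_of_le (fun k => mul_nonneg (by split_ifs <;> norm_num) (hc0 k)) (fun k => ?_) hcs
    exact mul_le_of_le_one_left (hc0 k) (by split_ifs <;> norm_num)
  -- the split
  have hsplit : ∑' k : Fin 2 → ℤ, (if |k 0| < (K : ℤ) then (1 : ℝ) else 0) * c k ≤
      ∑' k : Fin 2 → ℤ, (if |k 1| < (Λ : ℤ) then (1 : ℝ) else 0) * c k +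
        ∑' k : Fin 2 → ℤ, (if k ∈ W then (1 : ℝ) else 0) * c k +
        ∑' k : Fin 2 → ℤ, (if (R : ℝ) ≤ |((k 1 : ℤ) : ℝ)| then (1 : ℝ) else 0) * c k := by
    rw [← (hI _).tsum_add (hI _), ← ((hI _).add (hI _)).tsum_add (hI _)]
    refine (hI _).tsum_le_tsum (fun k => ?_) (((hI _).add (hI _)).add (hI _))
    rw [← add_mul, ← add_mul]
    exact mul_le_mul_of_nonneg_right (strip_indicator_le k (hWmem k)) (hc0 k)
  refine hsplit.trans (add_le_add (add_le_add ?_ ?_) ?_)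
  · -- low fibres pass through the V half-step exactly
    have h := tsum_verticalWeight_vstep (a' := a (j + 1)) hbs.continuous Ψ (hab j)
      (w := fun m : ℤ => if |m| < (Λ : ℤ) then (1 : ℝ) else 0) (C := 1)
      (fun m => by split_ifs <;> norm_num)
    exact le_of_eq h
  · -- the choppable block
    rw [tsum_eq_sum (s := W) (fun k hk => by simp [hk])]
    have e : ∑ k ∈ W, (if k ∈ W then (1 : ℝ) else 0) * c k = ∑ k ∈ W, ‖mFourierCoeff (bC ∘ shearMap 1 0 Ψ) k‖ ^ 2 :=
      Finset.sum_congr rfl fun k hk => by rw [if_pos hk, one_mul, hc, haC']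
    rw [e]
    exact sum_stripBlock_vstep_le_log2 P hγ hδ₀ hd hN₀ hρN j hbc hbsum hb1 hQ hΛ W hW hd₀ hM hMδ hMd hAd hε0 hε
  · -- the far fibres
    have h := tsum_far_iterate_le P hγ0 hδ₀ hd a b has h0 hb hab (j + 1) 1 (R := (R : ℝ)) (by exact_mod_cast hR)
    exact h

end Cascade

end Summit.AnomalousDissipation.AnomalousDissipation.Theorems.SawtoothPulseCascade.K1Window
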